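import Mathlib
import Literature.Analysis.FluidPDE.Tao2016AveragedNS.ViscousEnvelopeSmoothing
import Summits.NavierStokesRegularity.NavierStokesRegularity.Theorems.SubOnsagerCeilingOrthantTailCeiling.Negative.OrthantTailCeilingFalseOfSideBranchEscape
import HarnessLib

/-!
# `SubOnsagerCeiling.OrthantTailCeiling` (stmt-NavierStokesRegularity-25507) — negative lemma modulo
# an A PRIORI ESCAPE ESTIMATE (no solutions to construct)

The landed negative lemma `orthantTailCeiling_false_of_sideBranchEscape` (prover-ns-soc-p2-g2) is
modulo `SideBranchEscape`: for every depth `K` one must EXHIBIT a regular `ν`-viscous solution of the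
side-branch table `α_SB` that has lost a fixed fraction of its energy from the block `0..K` — an
existence-plus-estimate statement (and global regularity of `α_SB` at small `ν` on a fixed window is
itself part of what the rung asks).  This file removes the existence half: under the CEILING the tree's
smoothing engine (`exists_viscousGlobal_of_subcriticalEnvelope_of_inTableClass`, with cone invariance
`OrthantInvariance` and the admissibility of `α_SB`) supplies global regular solutions for EVERY
`ν > 0`, and a global solution restricted (clamped) to a window is a regular solution on that window.
Hence it suffices to know the A PRIORI ESTIMATE

* `SideBranchEscapeEstimateAt ε₀` (`Prop`, NOTHING asserted): there are `ρ > 0`, `T₀ > 0` and a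
  one-shell datum `X₀` of positive energy such that for every depth `K` there is `ν₀ > 0` such that
  for every viscosity `0 < ν ≤ ν₀` some time `s ∈ (0, T₀]` has the property that EVERY regular
  `ν`-viscous solution of `α_SB` on `[0, s]` from `X₀` satisfies `Σ_{k ≤ K} Σ_i ½X_{i,k}(s)² ≤ (1−ρ)E₀`
  (universally quantified over solutions; vacuous where none exists),

to refute the crux: **`orthantTailCeiling_false_of_sideBranchEscapeEstimate :
SideBranchEscapeEstimate → ¬ OrthantTailCeiling`** (BY NAME; `SideBranchEscapeEstimate :=
∃ ε₀ ∈ (0,1], SideBranchEscapeEstimateAt ε₀`).  The estimate is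
the natural output of an inviscid-limit / anomalous-dissipation argument for the Katz–Pavlović
conveyor of `α_SB` (numerics: ≈ 10 % of `E₀` leaves every block, `ν`-stably;
`Cruxes/OrthantTailCeiling/REFUTATION-EVIDENCE.md` §5), which never needs to construct solutions.

HONEST FRAMING: MODEL lattice ODEs only (route SubOnsagerCeiling, rung TL-M2Break); a conditional
refutation plus an elementary restriction lemma; settles nothing by itself; nothing bears on
Navier–Stokes regularity. [cite: Tao2016AveragedNS, §4 (4.5), the viscous equation before Thm. 4.2]
-/

noncomputable section

-- the sub-problem namespace `NavierStokesRegularity.NavierStokesRegularity` is the tree's layout (D-0017)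
set_option linter.dupNamespace false

namespace Summit.NavierStokesRegularity.NavierStokesRegularity.Theorems.SubOnsagerCeiling

open Set Filter
open scoped Topology
open Literature.Analysis.FluidPDE.TaoCascade
open Summit.NavierStokesRegularity.NavierStokesRegularity.Theses.SubOnsagerCeiling

/-! ## Restricting a global regular solution to a window -/

/-- **A global regular viscous solution, clamped to `[0, s]`, is a regular solution on the window
`[0, s]`** in the sense of the route's statements: one-shell datum, no shells below `0` (for all real
`t`), Tao's weight bound (4.5) for all real `t`, continuity on `ℝ`, and the exact viscous equation
within `[0, s]`. The clamped family is `t ↦ X(max 0 (min t s))`. [cite: Tao2016AveragedNS, §4 (4.5)] -/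
theorem viscousGlobal_window {ε₀ ν s : ℝ} {α : Fin 4 → Fin 4 → Fin 4 → ℤ × ℤ × ℤ → ℝ}
    {X₀ : Fin 4 → ℝ} {X : Fin 4 → ℤ → ℝ → ℝ} (hX : ViscousGlobal ε₀ ν α X₀ X) (hs : 0 < s) :
    (∀ (i : Fin 4) (k : ℤ), (fun i k t => X i k (max 0 (min t s))) i k 0 = if k = 0 then X₀ i else 0) ∧
    (∀ (i : Fin 4) (k : ℤ), k < 0 → ∀ t : ℝ, (fun i k t => X i k (max 0 (min t s))) i k t = 0) ∧
    (∃ M : ℝ, ∀ (t : ℝ) (i : Fin 4) (k : ℤ),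
      (1 + (1 + ε₀) ^ ((10 : ℝ) * k)) * |(fun i k t => X i k (max 0 (min t s))) i k t| ≤ M) ∧
    (∀ (i : Fin 4) (k : ℤ), Continuous ((fun i k t => X i k (max 0 (min t s))) i k)) ∧
    (∀ (i : Fin 4) (k : ℤ), ∀ t ∈ Icc (0 : ℝ) s,
      HasDerivWithinAt ((fun i k t => X i k (max 0 (min t s))) i k)
        (quadTerm ε₀ α (fun i k t => X i k (max 0 (min t s))) i k t -
          ν * (1 + ε₀) ^ ((2 : ℝ) * k) * (fun i k t => X i k (max 0 (min t s))) i k t)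
        (Icc (0 : ℝ) s) t) := by
  set c : ℝ → ℝ := fun t => max 0 (min t s) with hc
  have hc_mem : ∀ t, c t ∈ Icc 0 s := fun t =>
    ⟨le_max_left _ _, max_le hs.le (min_le_right _ _)⟩
  have hc_id : ∀ t ∈ Icc 0 s, c t = t := fun t ht => by
    simp only [hc]; rw [min_eq_left ht.2, max_eq_right ht.1]
  have hc0 : c 0 = 0 := hc_id 0 ⟨le_rfl, hs.le⟩
  have hcont_c : Continuous c := continuous_const.max (continuous_id.min continuous_const)
  refine ⟨fun i k => ?_, fun i k hk t => ?_, ?_, fun i k => ?_, fun i k t ht => ?_⟩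
  · show X i k (c 0) = _; rw [hc0]; exact hX.init i k
  · show X i k (c t) = 0; exact hX.noLow i k (c t) hk (hc_mem t).1
  · obtain ⟨M, hM⟩ := hX.apriori s hs
    exact ⟨M, fun t i k => hM (c t) (hc_mem t) i k⟩
  · show Continuous fun t => X i k (c t)
    have h1 : ContinuousOn (X i k) (Ici 0) := (hX.contDiffOn i k).continuousOn
    exact h1.comp_continuous hcont_c fun t => (hc_mem t).1
  · -- within `[0, s]` the clamped family IS `X`
    have heq : EqOn (fun t => X i k (c t)) (X i k) (Icc 0 s) := fun r hr => by
      show X i k (c r) = X i k r; rw [hc_id r hr]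
    have hd : HasDerivWithinAt (X i k) (derivWithin (X i k) (Ici 0) t) (Ici 0) t :=
      (((hX.contDiffOn i k).differentiableOn one_ne_zero) t (mem_Ici.2 ht.1)).hasDerivWithinAt
    rw [hX.motion i k t ht.1] at hd
    have hd' := hd.mono (Icc_subset_Ici_self : Icc (0 : ℝ) s ⊆ Ici 0)
    -- the right-hand sides agree at `t` (the quadratic term only sees time `t`)
    have hq : quadTerm ε₀ α (fun i k t => X i k (c t)) i k t = quadTerm ε₀ α X i k t := by
      simp only [quadTerm, hc_id t ht]
    show HasDerivWithinAt (fun t => X i k (c t)) _ (Icc 0 s) t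
    rw [hq]
    refine (hd'.congr heq ?_).congr_deriv ?_
    · exact (heq ht)
    · show _ = _ - ν * (1 + ε₀) ^ ((2 : ℝ) * k) * X i k (c t)
      rw [hc_id t ht]

/-! ## The a priori escape estimate and the refutation modulo it -/

/-- **`SideBranchEscapeEstimateAt ε₀` — A PRIORI ANOMALOUS-ESCAPE ESTIMATE for the side-branch table
at scale ratio `1+ε₀`** (`Prop`; NOTHING asserted; the hypothesis this negative lemma is modulo).
There are a fraction `ρ > 0`, a horizon `T₀ > 0` and a one-shell datum `X₀` of positive energy such
that for every depth `K` there is a viscosity threshold `ν₀ > 0` such that for every `0 < ν ≤ ν₀`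
some time `s ∈ (0, T₀]` has: EVERY regular solution of the `ν`-viscous `α_SB` lattice on `[0, s]`
from `X₀` (one-shell datum, no shells below `0`, weight bound (4.5), continuous modes, exact viscous
equation within `[0, s]`) has lost at least the fraction `ρ` of its energy from the block `0..K` by
time `s`: `Σ_{k ≤ K} Σ_i ½X_{i,k}(s)² ≤ (1−ρ)E₀`. Universally quantified over solutions — no solution
has to be constructed (the inviscid-limit cascade estimate for the Katz–Pavlović conveyor of `α_SB`
through its weak side drain; evidence `Cruxes/OrthantTailCeiling/REFUTATION-EVIDENCE.md` §5).
[cite: Tao2016AveragedNS, §4 (4.5), the viscous equation before Thm. 4.2] -/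
def SideBranchEscapeEstimateAt (ε₀ : ℝ) : Prop :=
  ∃ ρ : ℝ, 0 < ρ ∧ ∃ T₀ : ℝ, 0 < T₀ ∧ ∃ X₀ : Fin 4 → ℝ, 0 < (∑ i : Fin 4, (1 / 2 : ℝ) * X₀ i ^ 2) ∧
    ∀ K : ℕ, ∃ ν₀ : ℝ, 0 < ν₀ ∧ ∀ ν : ℝ, 0 < ν → ν ≤ ν₀ → ∃ s : ℝ, 0 < s ∧ s ≤ T₀ ∧
      ∀ X : Fin 4 → ℤ → ℝ → ℝ,
        (∀ (i : Fin 4) (k : ℤ), X i k 0 = if k = 0 then X₀ i else 0) →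
        (∀ (i : Fin 4) (k : ℤ), k < 0 → ∀ t : ℝ, X i k t = 0) →
        (∃ M : ℝ, ∀ (t : ℝ) (i : Fin 4) (k : ℤ), (1 + (1 + ε₀) ^ ((10 : ℝ) * k)) * |X i k t| ≤ M) →
        (∀ (i : Fin 4) (k : ℤ), Continuous (X i k)) →
        (∀ (i : Fin 4) (k : ℤ), ∀ t ∈ Set.Icc (0 : ℝ) s, HasDerivWithinAt (X i k)
          (quadTerm ε₀ sideBranchTable X i k t - ν * (1 + ε₀) ^ ((2 : ℝ) * k) * X i k t)
          (Set.Icc (0 : ℝ) s) t) →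
        (∑ k ∈ Finset.range (K + 1), ∑ i : Fin 4, (1 / 2 : ℝ) * X i (k : ℤ) s ^ 2) ≤
          (1 - ρ) * ∑ i : Fin 4, (1 / 2 : ℝ) * X₀ i ^ 2

/-- `SideBranchEscapeEstimate`: the a priori escape estimate at SOME scale ratio `ε₀ ∈ (0, 1]`
(`Prop`; nothing asserted). [this file] -/
def SideBranchEscapeEstimate : Prop :=
  ∃ ε₀ : ℝ, 0 < ε₀ ∧ ε₀ ≤ 1 ∧ SideBranchEscapeEstimateAt ε₀

/-- **CEILING ⇒ global regular solutions of `α_SB` for every viscosity** (the existence half, free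
under the ceiling): the per-shell/tail ceiling `CeilingAt 10 ε₀ sideBranchTable` with `θ > 1/2` is a
subcritical envelope (`η = 2θ − 1`) for all regular solutions on windows — non-negativity above the
datum shell coming from cone invariance (`subOnsagerCeiling_orthantInvariance_proof`, the orthant
property `sideBranchTable_orthant`) — so the tree's smoothing engine gives `ViscousGlobal` from every
datum at every `ν > 0`. [cite: Tao2016AveragedNS, §4 (4.5), (4.13)] -/
theorem sideBranch_viscousGlobal_of_ceilingAt {ε₀ : ℝ} (hε : 0 < ε₀)
    (hceil : CeilingAt 10 ε₀ sideBranchTable) (ν : ℝ) (hν : 0 < ν) (X₀ : Fin 4 → ℝ) :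
    ∃ X : Fin 4 → ℤ → ℝ → ℝ, ViscousGlobal ε₀ ν sideBranchTable X₀ X := by
  obtain ⟨θ, hθ, C, _hC0, H⟩ := hceil sideBranchTable_inTableClass sideBranchTable_orthant
  have hη : 0 < 2 * θ - 1 := by linarith
  have hI := subOnsagerCeiling_orthantInvariance_proof
  unfold Summit.NavierStokesRegularity.NavierStokesRegularity.Theses.SubOnsagerCeiling.OrthantInvariance
    at hI
  refine exists_viscousGlobal_of_subcriticalEnvelope_of_inTableClass hε.le hη hν
    sideBranchTable_inTableClass X₀ (fun T _hT => ⟨C * (∑ i : Fin 4, (1 / 2 : ℝ) * X₀ i ^ 2),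
      fun s hs Y hinit hlow hbd hcont hder n N hnN t ht => ?_⟩)
  have hnonneg := hI ε₀ ν hε hν sideBranchTable sideBranchTable_orthant X₀ s hs.1 Y hinit hlow hbd
    hcont hder
  have hc := H ν hν X₀ s hs.1 Y hinit hlow hbd hcont hder hnonneg n N hnN t ht
  have hexp : -((1 + (2 * θ - 1)) * (n : ℝ)) = -(2 * θ * (n : ℝ)) := by ring
  rw [hexp]
  exact hc

/-- **Under the ceiling, the a priori estimate yields the escaping solutions**:
`CeilingAt 10 ε₀ α_SB ∧ SideBranchEscapeEstimateAt ε₀ ⇒ SideBranchEscapeAt ε₀` (take the global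
regular solution of `sideBranch_viscousGlobal_of_ceilingAt` at a viscosity below both thresholds and
clamp it to the window of the estimate). [this file] -/
theorem sideBranchEscapeAt_of_ceilingAt_of_estimate {ε₀ : ℝ} (hε : 0 < ε₀)
    (hceil : CeilingAt 10 ε₀ sideBranchTable) (hE : SideBranchEscapeEstimateAt ε₀) :
    SideBranchEscapeAt ε₀ := by
  obtain ⟨ρ, hρ, T₀, hT₀, X₀, hE₀, hK⟩ := hE
  refine ⟨ρ, hρ, T₀, hT₀, X₀, hE₀, fun K ν₀ hν₀ => ?_⟩
  obtain ⟨ν₁, hν₁, hν⟩ := hK K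
  set ν : ℝ := min ν₀ ν₁ with hνdef
  have hνpos : 0 < ν := lt_min hν₀ hν₁
  obtain ⟨s, hs, hsT, hall⟩ := hν ν hνpos (min_le_right _ _)
  obtain ⟨X, hX⟩ := sideBranch_viscousGlobal_of_ceilingAt hε hceil ν hνpos X₀
  obtain ⟨hinit, hlow, hbd, hcont, hder⟩ := viscousGlobal_window hX hs
  set Xc : Fin 4 → ℤ → ℝ → ℝ := fun i k t => X i k (max 0 (min t s)) with hXc
  have hloss := hall Xc hinit hlow hbd hcont hder
  exact ⟨ν, hνpos, min_le_left _ _, s, hs, hsT, Xc, hinit, hlow, hbd, hcont, hder, hloss⟩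

/-- **NEGATIVE LEMMA modulo the A PRIORI ESCAPE ESTIMATE**: if for some scale ratio `ε₀ ∈ (0, 1]`
the estimate `SideBranchEscapeEstimateAt ε₀` holds, then the crux `OrthantTailCeiling` is FALSE
(by name). Chain: ceiling ⇒ `CeilingAt 10 ε₀ α_SB` ⇒ (engine) global regular solutions at every `ν`
⇒ (estimate, clamped window) `SideBranchEscapeAt ε₀` ⇒ (`not_ceilingAt_sideBranch_of_escape`,
pockets meter the conveyor) contradiction. [this file] -/
theorem orthantTailCeiling_false_of_sideBranchEscapeEstimate (h : SideBranchEscapeEstimate) :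
    ¬ Summit.NavierStokesRegularity.NavierStokesRegularity.Theses.SubOnsagerCeiling.OrthantTailCeiling := by
  intro hC
  obtain ⟨ε₀, hε, hε1, hE⟩ := h
  have hceil : CeilingAt 10 ε₀ sideBranchTable :=
    (orthantTailCeiling_iff_ceilingAt.1 hC) 10 (by norm_num) ε₀ hε hε1 sideBranchTable
  exact not_ceilingAt_sideBranch_of_escape hε (sideBranchEscapeAt_of_ceilingAt_of_estimate hε hceil hE)
    hceil

end Summit.NavierStokesRegularity.NavierStokesRegularity.Theorems.SubOnsagerCeiling

end
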